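import Mathlib
import Summits.KontsevichZagierPeriods.KontsevichZagierPeriods.Theorems.InverseLandauTateLiftingSqrtSubst
import Summits.KontsevichZagierPeriods.KontsevichZagierPeriods.Theorems.InverseLandauTateLiftingDimOneUnitChart

/-!
# `TateLifting` (stmt-KontsevichZagierPeriods-9129), line `Sketch` — stub 35 `tateLifting_sqrtReduce`

THE EULER REDUCTION OF `ℚ̄(x, √x)`-INTEGRANDS (first case of the Euler substitution). Let
`K = ℚ̄ ∩ ℝ = algebraicClosure ℚ ℝ` be the field of real algebraic numbers and let
`r = [σ, R(x, √x)]` be a one-dimensional representation with `σ ⊆ (0, ∞)` whose integrand is, on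
`σ`, the value at `(x, √x)` of a rational function `R = P/Q`, `P, Q ∈ K[X₀, X₁]`, `Q(x, √x) ≠ 0`
on `σ`. The square substitution `x = t²` (`tateLifting_sqrtSubst`, Kontsevich–Zagier's rule (2))
produces the honest representation `ρ = [D', 2t · R(t², √(t²))]`, `D' = {t > 0 | t² ∈ σ}`, with
`[r] − [ρ] ∈ KZ.relations`; since `√(t²) = t` for `t > 0`, its integrand is on `D'` the RATIONAL
function
`2t · P(t², t) / Q(t², t)` of `t`, read by the real polynomials

* `p := (MvPolynomial.aeval ![X², X] (2 X₁ P)).map (algebraMap K ℝ)`,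
* `q := (MvPolynomial.aeval ![X², X] Q).map (algebraMap K ℝ)`,

both with real-algebraic coefficients (`DimOne.uc_isAlgebraic_coeff`), `q(t) = Q(t², t) ≠ 0` on
`D'`. This puts `r` in the landed dimension-one sector with algebraic coefficients
(`kzKernelConjecture_lowDimAlg`).

References: M. Kontsevich, D. Zagier, *Periods* (2001), §1.2 rule (2).
-/

noncomputable section

open MeasureTheory Set Polynomial
open Literature.NumberTheory.Transcendental

namespace Summit.KontsevichZagierPeriods.InverseLandau

namespace SqrtReduce

/-- Evaluating at a real `t` the real polynomial attached to the substitution `X₀ ↦ X², X₁ ↦ X` of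
`P ∈ K[X₀, X₁]` (`K = ℚ̄ ∩ ℝ`) is evaluating `P` at `(t², t)`. [folklore] -/
theorem sr_eval_map_aeval (P : MvPolynomial (Fin 2) (algebraicClosure ℚ ℝ)) (t : ℝ) :
    ((MvPolynomial.aeval (![X ^ 2, X] : Fin 2 → (algebraicClosure ℚ ℝ)[X]) P).map
        (algebraMap (algebraicClosure ℚ ℝ) ℝ)).eval t =
      MvPolynomial.aeval ![t ^ 2, t] P := by
  have hg : (fun i => Polynomial.aeval t ((![X ^ 2, X] : Fin 2 → (algebraicClosure ℚ ℝ)[X]) i)) =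
      ![t ^ 2, t] := by
    funext i
    fin_cases i <;> simp
  rw [Polynomial.eval_map, ← Polynomial.aeval_def, ← AlgHom.comp_apply, MvPolynomial.comp_aeval, hg]

/-- `(2 X₁ P)(t², t) = 2t · P(t², t)`. [folklore] -/
theorem sr_aeval_two_mul (P : MvPolynomial (Fin 2) (algebraicClosure ℚ ℝ)) (t : ℝ) :
    (MvPolynomial.aeval ![t ^ 2, t] (2 * MvPolynomial.X 1 * P) : ℝ) =
      2 * t * MvPolynomial.aeval ![t ^ 2, t] P := by
  simp

end SqrtReduce

/-- **Euler reduction of `ℚ̄(x, √x)`-integrands** (stub 35 `tateLifting_sqrtReduce` of the lead's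
skeleton): a one-dimensional representation `r = [σ, P(x, √x)/Q(x, √x)]` with `σ ⊆ (0,∞)`,
`P, Q ∈ K[X₀, X₁]` (`K = ℚ̄ ∩ ℝ`), `Q(x, √x) ≠ 0` on `σ`, differs by relations from a representation
`ρ` whose integrand reads on its domain as `p(t)/q(t)` with `p, q ∈ ℝ[t]` having real-algebraic
coefficients and `q ≠ 0` there: `ρ = [D', 2t · r.integrand (t²)]` is the square substitution
`x = t²` of `r` (`tateLifting_sqrtSubst`, rule (2)), `D' = {t > 0 | t² ∈ σ}`, on which
`√(t²) = t` and the integrand is `2t P(t², t)/Q(t², t)`.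
[cite: KontsevichZagier2001, §1.2 rule (2)] -/
theorem tateLifting_sqrtReduce :
    ∀ (P Q : MvPolynomial (Fin 2) (algebraicClosure ℚ ℝ)) (r : KZ.IntegralRep 1),
      (∀ x ∈ r.domain, 0 < x 0) →
      (∀ x ∈ r.domain, MvPolynomial.aeval ![x 0, Real.sqrt (x 0)] Q ≠ 0) →
      Set.EqOn r.integrand (fun x => MvPolynomial.aeval ![x 0, Real.sqrt (x 0)] P /
        MvPolynomial.aeval ![x 0, Real.sqrt (x 0)] Q) r.domain →
      ∃ (ρ : KZ.IntegralRep 1) (p q : Polynomial ℝ), (∀ i, IsAlgebraic ℚ (p.coeff i)) ∧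
        (∀ i, IsAlgebraic ℚ (q.coeff i)) ∧ (∀ x ∈ ρ.domain, q.eval (x 0) ≠ 0) ∧
        Set.EqOn ρ.integrand (fun x => p.eval (x 0) / q.eval (x 0)) ρ.domain ∧
        KZ.of r - KZ.of ρ ∈ KZ.relations := by
  intro P Q r hpos hQ hPQ
  obtain ⟨ρ, hdom, hint, hrel⟩ := tateLifting_sqrtSubst r hpos
  refine ⟨ρ,
    (MvPolynomial.aeval (![X ^ 2, X] : Fin 2 → (algebraicClosure ℚ ℝ)[X])
      (2 * MvPolynomial.X 1 * P)).map (algebraMap (algebraicClosure ℚ ℝ) ℝ),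
    (MvPolynomial.aeval (![X ^ 2, X] : Fin 2 → (algebraicClosure ℚ ℝ)[X]) Q).map
      (algebraMap (algebraicClosure ℚ ℝ) ℝ),
    DimOne.uc_isAlgebraic_coeff _, DimOne.uc_isAlgebraic_coeff _, fun x hx => ?_, fun x hx => ?_,
    hrel⟩
  · -- `q(t) = Q(t², t) = Q(t², √(t²)) ≠ 0` at the point `t² ∈ σ`
    have hx' : 0 < x 0 ∧ (fun _ : Fin 1 => x 0 ^ 2) ∈ r.domain := by
      rw [hdom] at hx
      exact hx
    have h : (MvPolynomial.aeval ![x 0 ^ 2, Real.sqrt (x 0 ^ 2)] Q : ℝ) ≠ 0 :=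
      hQ (fun _ : Fin 1 => x 0 ^ 2) hx'.2
    rw [Real.sqrt_sq hx'.1.le] at h
    rwa [SqrtReduce.sr_eval_map_aeval]
  · -- `ρ.integrand t = 2t · r.integrand (t²) = 2t · P(t², t)/Q(t², t) = p(t)/q(t)`
    have hx' : 0 < x 0 ∧ (fun _ : Fin 1 => x 0 ^ 2) ∈ r.domain := by
      rw [hdom] at hx
      exact hx
    have h : r.integrand (fun _ : Fin 1 => x 0 ^ 2) =
        MvPolynomial.aeval ![x 0 ^ 2, Real.sqrt (x 0 ^ 2)] P /
          MvPolynomial.aeval ![x 0 ^ 2, Real.sqrt (x 0 ^ 2)] Q := hPQ hx'.2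
    rw [Real.sqrt_sq hx'.1.le] at h
    show ρ.integrand x = _ / _
    rw [SqrtReduce.sr_eval_map_aeval, SqrtReduce.sr_eval_map_aeval, SqrtReduce.sr_aeval_two_mul,
      hint hx]
    beta_reduce
    rw [h, mul_div_assoc]

end Summit.KontsevichZagierPeriods.InverseLandau

end
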